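import Summits.HodgeConjecture.HodgeConjecture.Theorems.F0P3cStCharTSSubmersionChart   -- ★ p852013 (F0P2-p01) D2: `exists_depth_submersion`
import Literature.MeasureTheory.Group.LinearSubmersionBound                             -- ★ p852008 (LH10-p01) D2-lin: `exists_setLIntegral_comp_le_mul_setLIntegral_image_continuousLinearMap`
import Literature.Analysis.Calculus.UltrametricNewtonChart                              -- ★ p851977 (F0P2-p01) D1: ball filtrations `exists_addSubgroup_coe_eq_closedBall`, `isCompact_…`, `mem_iff_norm_le_…`
import HarnessLib

/-!
# F0 · P3c · line LH6 «StCharTS» — road «HC-D», brick D5(i) FILE A «PULLBACK»: local integrability PULLS BACK ALONG A SUBMERSION AT A POINT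

Cell `pub/hodgecm-mathlib`, crux H413 = `stmt-HodgeConjecture-24833` (lane `--supports … --as helper`), route HCCMUnconditional; road «HC-D» (holder ∕ dealer
F0P2-p01 (g23), DEAL 2026-09-02T16:21:56Z), seat F0P3-p04 (g18).  THEOREMS ONLY (no definition ∕ instance ∕ notation ∕ named fact ∕ `sorry`); ★-only imports.
Theorems-level and not `Literature/` because its first input ★ D2 is a `Summits` module.  HONEST LABEL: count-neutral; HC_CM is proved only modulo the printed
citations (hLiu418 = `stmt-HodgeConjecture-24832`, h413 = `stmt-HodgeConjecture-24833`) until rung 0 closes.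

## Statement (`exists_nhds_setLIntegral_comp_lt_top`)

`𝕜` complete nontrivially normed; `V` a normed `𝕜`-space, ULTRAMETRIC and PROPER (so finite dimensional), Borel, `μ` an additive Haar measure on `V`; `A` a normed
`𝕜`-space, Borel, `ν` an additive Haar measure on `A`; `P : V → A` with STRICT derivative `P′` at `x₀` and `P′` ONTO.  If a measurable `f : A → ℝ≥0∞` has finite integral
on some neighbourhood of `P x₀`, then `f ∘ P` has finite integral on some neighbourhood of `x₀`:

  `(∃ W ∈ 𝓝 (P x₀), ∫⁻ a in W, f a ∂ν < ∞) → ∃ U ∈ 𝓝 x₀, ∫⁻ x in U, f (P x) ∂μ < ∞`.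

This is the analytic step of case (i) «regular points» of (HC-D) for `U(3)`: with `P = χ` the Chevalley map (onto differential at regular `X₀`, ★ D4a) and `f = |δ|^{−1∕2}`
(locally integrable on the coefficient space, D3c), `|η|^{−1∕2} = f ∘ χ` is integrable near every regular `X₀` [HarishChandra1970 Part VII §1 Thm. 15 — the statement paid;
the regular-set reduction is classical: the Chevalley map is submersive on the regular locus].

## Proof

A continuous linear right inverse `s` of `P′` exists (finite dimension).  Along the ball filtration `Λ_j = closedBall 0 2^{−j}` (additive subgroups, ★ D1) ★ D2
`exists_depth_submersion` gives, for deep `k`, `∫⁻_{Λ_k} f (P (x₀ + v)) ∂μ = ∫⁻_{Λ_k} f (P x₀ + P′ v) ∂μ` (a submersion integrates like its linearisation on small boxes);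
★ D2-lin bounds the right-hand side by `C · ∫⁻_{P′(Λ_k)} f (P x₀ + a) ∂ν` with `C < ∞` (`Λ_k` compact); for `k` deep enough `P x₀ + P′(Λ_k) ⊆ ball (P x₀) ε ⊆ W`
(`‖P′ v‖ ≤ ‖P′‖ 2^{−k}`); the two translations are measure preserving (`setLIntegral_comp_emb`), and `U := x₀ + Λ_k`.
-/

set_option autoImplicit false
-- the mandated namespace has the single-problem summit's repeated segment (`HodgeConjecture.HodgeConjecture`)
set_option linter.dupNamespace false

noncomputable section

open MeasureTheory Filter Metric Set Topology
open scoped ENNReal Pointwise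
open Summit.HodgeConjecture.HodgeConjecture.Cruxes.H413.F0P3cStCharTSSubmersionChart
open Literature.MeasureTheory.Group Literature.Analysis.Calculus

namespace Summit.HodgeConjecture.HodgeConjecture.Cruxes.H413.F0P3cStCharTSSubmersionPullback

variable {𝕜 : Type*} [NontriviallyNormedField 𝕜] [CompleteSpace 𝕜]
  {V : Type*} [NormedAddCommGroup V] [NormedSpace 𝕜 V] [IsUltrametricDist V] [ProperSpace V] [MeasurableSpace V] [BorelSpace V]
  {A : Type*} [NormedAddCommGroup A] [NormedSpace 𝕜 A] [MeasurableSpace A] [BorelSpace A]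
  (μ : Measure V) [μ.IsAddHaarMeasure] (ν : Measure A) [ν.IsAddHaarMeasure]

/-- **Local integrability pulls back along a submersion at a point.**  `P : V → A` with strict derivative `P′` at `x₀`, `P′` onto (`V` ultrametric proper normed
`𝕜`-space, `𝕜` complete; `μ`, `ν` additive Haar measures): if a measurable `f : A → ℝ≥0∞` has finite integral on a neighbourhood of `P x₀`, then `f ∘ P` has finite
integral on a neighbourhood of `x₀`.  (★ D2 `exists_depth_submersion` + ★ D2-lin + translations.)
[cite: Schikhof1984, §27 Lemma 27.4–Thm. 27.5] [cite: DeitmarEchterhoff2014, Thm. 1.5.3] [cite: HarishChandra1970, Part VII §1 Thm. 15] -/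
theorem exists_nhds_setLIntegral_comp_lt_top {P : V → A} {x₀ : V} (P' : V →L[𝕜] A) (hP : HasStrictFDerivAt P P' x₀)
    (hP' : Function.Surjective P') {f : A → ℝ≥0∞} (hf : Measurable f)
    (hfin : ∃ W ∈ 𝓝 (P x₀), ∫⁻ a in W, f a ∂ν < ∞) :
    ∃ U ∈ 𝓝 x₀, ∫⁻ x in U, f (P x) ∂μ < ∞ := by
  -- finite dimension and a continuous linear right inverse of `P'`
  haveI : FiniteDimensional 𝕜 V := FiniteDimensional.of_locallyCompactSpace 𝕜
  haveI : FiniteDimensional 𝕜 A := Module.Finite.of_surjective (P' : V →ₗ[𝕜] A) hP'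
  obtain ⟨s₀, hs₀⟩ := (P' : V →ₗ[𝕜] A).exists_rightInverse_of_surjective (LinearMap.range_eq_top.2 hP')
  let s : A →L[𝕜] V := LinearMap.toContinuousLinearMap s₀
  have hs : ∀ a, P' (s a) = a := fun a => by
    have h := LinearMap.congr_fun hs₀ a
    simpa [s] using h
  -- the ball filtration `Λ j = closedBall 0 (1 * (1/2)^j)` and the submersion chart (★ D2)
  obtain ⟨Λ, hΛ⟩ := exists_addSubgroup_coe_eq_closedBall (V := V) one_pos (by norm_num : (0 : ℝ) < 1 / 2)
  obtain ⟨k₀, hk₀⟩ := exists_depth_submersion μ P' hP s hs hΛ one_pos (by norm_num) (by norm_num)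
  -- a ball inside `W` and a depth `k₁` with `(‖P'‖ + 1) (1/2)^{k₁} < ε`
  obtain ⟨W, hW, hWfin⟩ := hfin
  obtain ⟨ε, hε, hεW⟩ := Metric.mem_nhds_iff.1 hW
  have hN : (0 : ℝ) < ‖P'‖ + 1 := by positivity
  obtain ⟨k₁, hk₁⟩ := exists_pow_lt_of_lt_one (div_pos hε hN) (by norm_num : (1 / 2 : ℝ) < 1)
  have hk₁' : (‖P'‖ + 1) * (1 / 2 : ℝ) ^ k₁ < ε := by
    rw [mul_comm]; exact (lt_div_iff₀ hN).1 hk₁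
  set k := max k₀ k₁ with hk
  obtain ⟨-, hint⟩ := hk₀ k (le_max_left _ _)
  -- the neighbourhood `U := x₀ + Λ k`
  have hΛk0 : (Λ k : Set V) ∈ 𝓝 (0 : V) := by
    rw [hΛ]; exact closedBall_mem_nhds _ (by positivity)
  have hU : (fun v => x₀ + v) '' (Λ k : Set V) ∈ 𝓝 x₀ := by
    have h := (Homeomorph.addLeft x₀).isOpenMap.image_mem_nhds hΛk0
    simpa using h
  refine ⟨(fun v => x₀ + v) '' (Λ k : Set V), hU, ?_⟩
  -- step 1: translate on `V` and linearise by ★ D2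
  have e1 : ∫⁻ v in (Λ k : Set V), f (P (x₀ + v)) ∂μ = ∫⁻ x in (fun v => x₀ + v) '' (Λ k : Set V), f (P x) ∂μ :=
    (measurePreserving_add_left μ x₀).setLIntegral_comp_emb (MeasurableEquiv.addLeft x₀).measurableEmbedding (fun x => f (P x)) _
  rw [← e1, hint f hf]
  -- step 2: ★ D2-lin on the compact box
  obtain ⟨C, hC, hle⟩ := exists_setLIntegral_comp_le_mul_setLIntegral_image_continuousLinearMap μ ν P' hP'
    (isCompact_of_coe_eq_closedBall hΛ k)
  have hg : AEMeasurable (fun a => f (P x₀ + a)) ν := (hf.comp (measurable_const_add (P x₀))).aemeasurable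
  refine lt_of_le_of_lt (hle _ hg) (ENNReal.mul_lt_top hC ?_)
  -- step 3: translate on `A` and enlarge to `W`
  have e2 : ∫⁻ a in (P' : V → A) '' (Λ k : Set V), f (P x₀ + a) ∂ν = ∫⁻ y in (fun a => P x₀ + a) '' ((P' : V → A) '' (Λ k : Set V)), f y ∂ν :=
    (measurePreserving_add_left ν (P x₀)).setLIntegral_comp_emb (MeasurableEquiv.addLeft (P x₀)).measurableEmbedding f _
  rw [e2]
  have hsub : (fun a => P x₀ + a) '' ((P' : V → A) '' (Λ k : Set V)) ⊆ W := by
    rintro _ ⟨a, ⟨v, hv, rfl⟩, rfl⟩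
    apply hεW
    rw [Metric.mem_ball, dist_eq_norm, add_sub_cancel_left]
    have hvn : ‖v‖ ≤ 1 * (1 / 2 : ℝ) ^ k := (mem_iff_norm_le_of_coe_eq_closedBall hΛ).1 hv
    have hpow : (1 / 2 : ℝ) ^ k ≤ (1 / 2 : ℝ) ^ k₁ := pow_le_pow_of_le_one (by norm_num) (by norm_num) (le_max_right _ _)
    calc ‖P' v‖ ≤ ‖P'‖ * ‖v‖ := P'.le_opNorm v
      _ ≤ ‖P'‖ * (1 / 2 : ℝ) ^ k := by rw [one_mul] at hvn; exact mul_le_mul_of_nonneg_left hvn (norm_nonneg _)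
      _ ≤ (‖P'‖ + 1) * (1 / 2 : ℝ) ^ k₁ := mul_le_mul (by linarith) hpow (by positivity) hN.le
      _ < ε := hk₁'
  exact lt_of_le_of_lt (lintegral_mono_set hsub) hWfin

/-- **Pointwise on a set**: if `P` is a submersion at every point of `S` (strict derivative onto) and `f` has finite integral near every point of `P '' S`, then `f ∘ P` has finite
integral near every point of `S` — e.g. `S` = the regular locus, `P = χ`. [cite: HarishChandra1970, Part VII §1 Thm. 15] [cite: Schikhof1984, §27 Lemma 27.4–Thm. 27.5] -/
theorem forall_exists_nhds_setLIntegral_comp_lt_top {P : V → A} {S : Set V} (P' : V → (V →L[𝕜] A))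
    (hP : ∀ x ∈ S, HasStrictFDerivAt P (P' x) x) (hP' : ∀ x ∈ S, Function.Surjective (P' x)) {f : A → ℝ≥0∞} (hf : Measurable f)
    (hfin : ∀ x ∈ S, ∃ W ∈ 𝓝 (P x), ∫⁻ a in W, f a ∂ν < ∞) :
    ∀ x ∈ S, ∃ U ∈ 𝓝 x, ∫⁻ y in U, f (P y) ∂μ < ∞ :=
  fun x hx => exists_nhds_setLIntegral_comp_lt_top μ ν (P' x) (hP x hx) (hP' x hx) hf (hfin x hx)

end Summit.HodgeConjecture.HodgeConjecture.Cruxes.H413.F0P3cStCharTSSubmersionPullback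

end
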